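import Mathlib.MeasureTheory.Measure.SubFinite
import Summits.QuantumFields.YangMills.Theorems.BalabanUVNodesN08MassesACDominated

/-!
# BalabanUVNodes ∕ N08 — THE LEAST CLOSED FAMILY: the WEAK-closure form of the mass-bound reduction for print's iterated Radon–Nikodym history
# masses `MassesAC.massRecAC`, the LEAST weakly-closed family `ν♯` (the iterated one-step EXCESS of the transported reference measure over Haar),
# its minimality, and the corollary «Haar compatibility ⇒ `m_k ≤ 1` a.e.»

Track A, DAG node N08 = T. Bałaban, CMP **102** (1985) 255–275 [Balaban1985UV3]: (41) p. 266 (the history masses), (48) p. 268 (one transport step), (5)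
p. 256 (the extensive shape `e^{O(1)|T₁^{(k)}|}`); the averaging (2) = [Balaban1985Averaging] (15) p. 19, the transformation (10) p. 19.  Cell `pub-ymgap`,
width seat `pub-ymgap-dag-n08-w1` (g4), W-SEAT-START-LIST §n08 item 1 successor piece (o11) = file 17; `--supports` K1⁷ `StabilityBAtRecordR13SepCoPH`
(helper).  Companion ∕ CORRECTION of file 16 `…N08MassesACDominated` (p608467).

WHY THIS FILE (located, count-neutral).  File 16 reduced the extensive mass bound of file 15's (R4⁗) to ANY family of measures `ν_k` closed in the STRONG
sense `(dU_k + ν_k)∘Ū_k⁻¹ ≤ ν_{k+1}` (it bounded the trivial history's floor `max 1 T` by `1 + T`).  Every strongly-closed family contains the k Haar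
copies `Σ_{j<k} (Ū_{k−1}∘⋯∘Ū_j)_* dU_j` — total mass `k`, hence a density of `dV_k`-mean `≥ k` — so the letter «density `≤ e^{c|T₁^{(k)}|} − 1`, `c`
independent of ε» is NOT uniformly satisfiable in that currency (`log(k+1) ≤ c|T₁^{(k)}|` fails as `K → ∞` at fixed volume exponent).  The repair is
the floor itself: `max 1 T`, read as the `sup` of two dominated densities, is dominated by the SAME measure (§1), so the induction closes under the WEAK
closure `(dU_k + ν_k)∘Ū_k⁻¹ ≤ dU_{k+1} + ν_{k+1}` (§2) — exactly the shape of the guard family n08-w3 g4 exhibited for print's averaging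
(`…HaarCompatibilityGuardTransport.map_add_le_closure_avOfPrint`, p609378) — and the LEAST such family is the iterated one-step EXCESS over Haar,
`ν♯_0 = 0`, `ν♯_{k+1} = ((dU_k + ν♯_k)∘Ū_k⁻¹ − dU_{k+1})⁺` (Mathlib's truncated subtraction of measures `Measure.sub` = the least `τ` with `· ≤ τ + dU_{k+1}`),
which VANISHES under Haar compatibility (§5: the std lane's cap `m ≤ 1` as a theorem of the AC masses, a.e.).

WHAT THIS FILE PROVES (kernel; theorems only, 0 def; [folklore] measure theory about the lane's DEFINED objects; nothing of the paper asserted).  For ANY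
averaging family `av` with `AvgAC` at every level (only measurability of `Ū` is used), ANY thresholds `M₁, Rcol, ε_L, ε_S`:
* §1 `withDensity_sup_le` — `μ.withDensity f ≤ μ′ ∧ μ.withDensity g ≤ μ′ ⇒ μ.withDensity (f ⊔ g) ≤ μ′`.
* §2 ★★★ `withDensity_massRecAC_le_of_weakClosed` — **WEAK CLOSURE `(dU_k + ν_k)∘Ū_k⁻¹ ≤ dU_{k+1} + ν_{k+1}` (k < K̄) ⇒ `m_k(h,·)·dU_k ≤ dU_k + ν_k` (k ≤ K̄)**,
  every history; file 16's `withDensity_massRecAC_le` is the special case of a strongly-closed family (`withDensity_massRecAC_le_of_closed_range`).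
* §3 the a.e. forms: `massRecAC_le_ae_of_weakClosed` (`ν_k ≤ dU_k.withDensity B_k ⇒ m_k(h,·) ≤ 1 + B_k` a.e.), `…_real`, ★ `massRecAC_le_exp_ae_of_weakClosed`
  (`ν_k ≤ (e^{c_k} − 1)·dU_k ⇒ m_k(h,·) ≤ e^{c_k}` a.e. — the a.e. form of file 15's `hmass`).
* §4 ★★★ THE LEAST WEAKLY-CLOSED FAMILY — for any family obeying the EXCESS RECURSION `ν♯_0 = 0`, `ν♯_{k+1} = (dU_k + ν♯_k)∘Ū_k⁻¹ − dU_{k+1}` (it exists: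
  `exists_excessRec`): finite (`isFiniteMeasure_of_excessRec`), weakly closed (`weakClosed_of_excessRec`), BELOW EVERY weakly-closed family levelwise
  (`excessRec_le_of_weakClosed` — so §2∕§3 with `ν♯` are the weakest hypotheses of closed-family form), one-step bound `excessRec_succ_le`
  (`ν♯_{k+1} ≤ (dU_k∘Ū_k⁻¹ − dU_{k+1}) + ν♯_k∘Ū_k⁻¹`: the one-step excess of the averaging over Haar plus the transport of the old excess) and the mass
  bookkeeping `excessRec_univ_le` (`ν♯_k(univ) ≤ Σ_{j<k} ‖(dU_j∘Ū_j⁻¹ − dU_{j+1})⁺‖`).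
* §5 ★★ `massRecAC_le_one_ae_of_map_le` — **sub-Haar (equivalently exact Haar) compatibility `(dU_j)∘Ū_j⁻¹ ≤ dU_{j+1}` for `j < k` ⇒ `m_k(h,·) ≤ 1` `dU_k`-a.e.**
  (`ν := 0` is weakly closed): E6′ ⇒ the std lane's built-in cap, as a THEOREM about the AC masses — the honesty check of the whole reduction.
* (§4b) ★ `weakClosed_of_oneStepExcessRec` ∕ `excessRec_le_of_oneStepExcessRec` — the TRANSPORTED ONE-STEP EXCESSES `μ_{k+1} = (dU_k∘Ū_k⁻¹ − dU_{k+1}) +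
  μ_k∘Ū_k⁻¹` form a weakly-closed family dominating `ν♯`: the explicit intermediate analytic target (small-mass measures, not Haar copies).
The junction with n08-w3 g4's guard family at PRINT'S averaging (`…HaarCompatibilityGuardTransport`, p609378) is the companion file
`…N08MassesACLeastClosedFamilyPrint` (split off: it imports p609378).

LOCATED READING (count-neutral; plan ∕ node00-def ∕ pub-balaban3d ∕ the n08-w3 analysis lineage decide): (R4⁵) the analytic input (a) of `N08-E6PRIME-LOAD-POINT.md`
CORRECTED — the a.e. extensive mass bound at any averaging ⟸ «`dν♯_k∕dV_k ≤ e^{c|T₁^{(k)}|} − 1` dV_k-a.e.» with `ν♯` the iterated one-step excess over Haar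
(`= 0` under E6′; dominated by every weakly-closed family, in particular by n08-w3's guard family `ν_{j+1} = (dU_j↾G_j)∘Ū_j⁻¹ + ν_j∘Ū_j⁻¹` at print's
averaging).  Part (b) (version re-selection on the null set where the a.e. bound fails) is untouched.

HONEST FRAMING: count-neutral helper; no density bound for print's averaging is claimed — (a) stays OPEN; E6′ NOT decided; `hmass` NOT supplied; N08 NOT
discharged; one finite 𝕋⁴ programme at fixed ε, Bałaban AS PRINTED — R4 closes the conditional finite-𝕋⁴ rung `BalabanLadder.UV` only; the Yang–Mills mass gap
(Clay) is NOT proved by any of this; nothing continuum ∕ ℝ⁴ ∕ OS.  No `sorry`, standard axioms.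
-/

noncomputable section

open MeasureTheory
open scoped ENNReal

namespace Summit.QuantumFields.YangMills.BalabanUVNodes.N08MassesACLeastClosedFamily

open Literature.MathematicalPhysics.QuantumFieldTheory.Balaban1983to89
open Literature.MathematicalPhysics.QuantumFieldTheory.Balaban1983to89.AveragingRT (rnTransport rnTransport_nonneg)
open Summit.QuantumFields.Balaban3D.Carriers
open Summit.QuantumFields.Balaban3D.Proofs.MassesAC
open Summit.QuantumFields.YangMills.BalabanUVNodes.N08MassesACDominated (rnDeriv_le_of_le_withDensity withDensity_rnTransport_le)

/-! ## §1 The supremum of two dominated densities is dominated -/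
section Sup

variable {α : Type*} [MeasurableSpace α] {μ μ' : Measure α}

/-- **`μ.withDensity f ≤ μ′` and `μ.withDensity g ≤ μ′` imply `μ.withDensity (f ⊔ g) ≤ μ′`** (`f`, `g` measurable): split along the measurable set
`{f ≤ g}`, where the supremum is `g`, and its complement, where it is `f` (`restrict_withDensity`, `Measure.restrict_add_restrict_compl`). [folklore] -/
theorem withDensity_sup_le {f g : α → ℝ≥0∞} (hf : Measurable f) (hg : Measurable g) (hfμ : μ.withDensity f ≤ μ') (hgμ : μ.withDensity g ≤ μ') :
    μ.withDensity (fun x => max (f x) (g x)) ≤ μ' := by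
  have hs : MeasurableSet {x | f x ≤ g x} := measurableSet_le hf hg
  rw [← Measure.restrict_add_restrict_compl (μ := μ.withDensity fun x => max (f x) (g x)) hs,
    ← Measure.restrict_add_restrict_compl (μ := μ') hs]
  refine add_le_add ?_ ?_
  · have h1 : (μ.withDensity fun x => max (f x) (g x)).restrict {x | f x ≤ g x} = (μ.withDensity g).restrict {x | f x ≤ g x} := by
      rw [restrict_withDensity hs, restrict_withDensity hs]
      exact withDensity_congr_ae (ae_restrict_of_forall_mem hs fun x hx => max_eq_right hx)
    rw [h1]
    exact Measure.restrict_mono subset_rfl hgμ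
  · have h2 : (μ.withDensity fun x => max (f x) (g x)).restrict {x | f x ≤ g x}ᶜ = (μ.withDensity f).restrict {x | f x ≤ g x}ᶜ := by
      rw [restrict_withDensity hs.compl, restrict_withDensity hs.compl]
      refine withDensity_congr_ae (ae_restrict_of_forall_mem hs.compl fun x hx => max_eq_left ?_)
      have hx' : ¬ f x ≤ g x := hx
      exact (lt_of_not_ge hx').le
    rw [h2]
    exact Measure.restrict_mono subset_rfl hfμ

end Sup

/-! ## §2 The weak-closure form of the measure bound on the iterated AC masses -/
section WeakClosure

variable {P : Params} {G : Type} [GaugeGroup G] [MeasurableSpace G] [HaarData G]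
  (M₁ : ℕ) (Rcol : ℕ → ℕ) (εL εS : ℕ → ℝ) (av : ∀ j, Averaging P j G) (hav : ∀ j, AvgAC (av j).avg)
include hav

open Classical in
/-- ★★★ **THE ITERATED AC MASSES UNDER WEAK CLOSURE: `(dU_k + ν_k)∘Ū_k⁻¹ ≤ dU_{k+1} + ν_{k+1}` for `k < K̄` ⇒ `m_k(h,·)·dU_k ≤ dU_k + ν_k` for every
`k ≤ K̄` and every history `h`.**  Induction over the three cases of `MassesAC.massRecAC` as in file 16, except at the TRIVIAL history: its floor
`max 1 (T_k[…])` is the supremum of the densities `1` and `T_k[…]`, both dominated by `dU_{k+1} + ν_{k+1}` (`1` trivially; the transport by file 16's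
`withDensity_rnTransport_le` with target `dU_{k+1} + ν_{k+1}`), hence so is the floor (§1) — no Haar copy is injected.  Only measurability of `Ū` is used.
[cite: Balaban1985UV3, (41) p.266 + (48) p.268 (the masses; bookkeeping); Balaban1985Averaging, (10) p.19] -/
theorem withDensity_massRecAC_le_of_weakClosed (Kt : ℕ) (ν : ∀ k, Measure (GaugeField P k G))
    (hstep : ∀ k, k < Kt → (fieldMeasure P k G + ν k).map (av k).avg ≤ fieldMeasure P (k + 1) G + ν (k + 1)) :
    ∀ k, k ≤ Kt → ∀ h : Hist P k,
      (fieldMeasure P k G).withDensity (fun V => ENNReal.ofReal (massRecAC M₁ Rcol εL εS av k h V)) ≤ fieldMeasure P k G + ν k := by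
  intro k
  induction k with
  | zero =>
    intro _ h
    have h1 : (fun V => ENNReal.ofReal (massRecAC M₁ Rcol εL εS av 0 h V)) = fun _ => (1 : ℝ≥0∞) := by
      funext V; rw [massRecAC_zero]; simp
    rw [h1, withDensity_const, one_smul]
    exact Measure.le_add_right le_rfl
  | succ k ih =>
    intro hk h
    have hf0 : ∀ U, 0 ≤ stepWeight M₁ Rcol εL εS k h U * massRecAC M₁ Rcol εL εS av k h.proj U := fun U =>
      mul_nonneg (stepWeight_nonneg M₁ Rcol εL εS k h U) (massRecAC_nonneg M₁ Rcol εL εS av k _ U)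
    have hfm : ∀ U, stepWeight M₁ Rcol εL εS k h U * massRecAC M₁ Rcol εL εS av k h.proj U ≤ massRecAC M₁ Rcol εL εS av k h.proj U :=
      fun U => by
        have hw := stepWeight_le_one M₁ Rcol εL εS k h U
        have hm := massRecAC_nonneg M₁ Rcol εL εS av k h.proj U
        nlinarith [stepWeight_nonneg M₁ Rcol εL εS k h U]
    -- one transport step, with target `dU_{k+1} + ν_{k+1}` (the weak closure)
    have hT := withDensity_rnTransport_le av hav k hf0 hfm (ih (by omega) h.proj) (hstep k (by omega))
    by_cases ht : h = Hist.triv P (k + 1)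
    · -- trivial history: `max 1 (T[…])` = `1 ⊔ T[…]`, both dominated by `dU_{k+1} + ν_{k+1}`
      subst ht
      have hT' := hT
      rw [Hist.proj_triv] at hT'
      have heq : (fun V => ENNReal.ofReal (massRecAC M₁ Rcol εL εS av (k + 1) (Hist.triv P (k + 1)) V)) = fun V =>
          max ((fun _ => (1 : ℝ≥0∞)) V) (ENNReal.ofReal (rnTransport (av k).avg
            (fun U => stepWeight M₁ Rcol εL εS k (Hist.triv P (k + 1)) U * massRecAC M₁ Rcol εL εS av k (Hist.triv P k) U) V)) := by
        funext V
        rw [massRecAC_triv_succ, ENNReal.ofReal_max, ENNReal.ofReal_one]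
      rw [heq]
      refine withDensity_sup_le measurable_const (measurable_rnTransport _ _).ennreal_ofReal ?_ hT'
      rw [withDensity_const, one_smul]
      exact Measure.le_add_right le_rfl
    · by_cases hh : Hist.Admissible M₁ Rcol (k + 1) h
      · -- admissible non-trivial: the exact transport
        have heq : (fun V => ENNReal.ofReal (massRecAC M₁ Rcol εL εS av (k + 1) h V)) = fun V => ENNReal.ofReal (rnTransport (av k).avg
            (fun U => stepWeight M₁ Rcol εL εS k h U * massRecAC M₁ Rcol εL εS av k h.proj U) V) := by
          funext V; rw [massRecAC_succ M₁ Rcol εL εS av k h hh ht V]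
        rw [heq]
        exact hT
      · -- inadmissible: mass `0`
        have heq : (fun V => ENNReal.ofReal (massRecAC M₁ Rcol εL εS av (k + 1) h V)) = fun _ => (0 : ℝ≥0∞) := by
          funext V; rw [massRecAC_eq_zero_of_not_admissible M₁ Rcol εL εS av (k + 1) h V hh]; simp
        rw [heq, withDensity_const, zero_smul]
        exact bot_le

/-- File 16's STRONG closure `(dU_k + ν_k)∘Ū_k⁻¹ ≤ ν_{k+1}` is a special case of the weak one (range form of file 16's `withDensity_massRecAC_le`). [folklore] -/
theorem withDensity_massRecAC_le_of_closed_range (Kt : ℕ) (ν : ∀ k, Measure (GaugeField P k G))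
    (hstep : ∀ k, k < Kt → (fieldMeasure P k G + ν k).map (av k).avg ≤ ν (k + 1)) :
    ∀ k, k ≤ Kt → ∀ h : Hist P k,
      (fieldMeasure P k G).withDensity (fun V => ENNReal.ofReal (massRecAC M₁ Rcol εL εS av k h V)) ≤ fieldMeasure P k G + ν k :=
  withDensity_massRecAC_le_of_weakClosed M₁ Rcol εL εS av hav Kt ν fun k hk => (hstep k hk).trans (Measure.le_add_left le_rfl)

/-! ## §3 The a.e. forms -/

/-- ★ **a.e. FORM under weak closure**: if moreover `ν_k ≤ dU_k.withDensity B_k` then `m_k(h,·) ≤ 1 + B_k` `dU_k`-a.e. (in `ℝ≥0∞`), `k ≤ K̄`.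
[cite: Balaban1985UV3, (41) p.266 (the masses; bookkeeping)] -/
theorem massRecAC_le_ae_of_weakClosed (Kt : ℕ) (ν : ∀ k, Measure (GaugeField P k G))
    (hstep : ∀ k, k < Kt → (fieldMeasure P k G + ν k).map (av k).avg ≤ fieldMeasure P (k + 1) G + ν (k + 1))
    (B : ∀ k, GaugeField P k G → ℝ≥0∞) (hνB : ∀ k, k ≤ Kt → ν k ≤ (fieldMeasure P k G).withDensity (B k))
    (k : ℕ) (hk : k ≤ Kt) (h : Hist P k) :
    ∀ᵐ V ∂(fieldMeasure P k G), ENNReal.ofReal (massRecAC M₁ Rcol εL εS av k h V) ≤ 1 + B k V := by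
  have hmeas : Measurable fun V => ENNReal.ofReal (massRecAC M₁ Rcol εL εS av k h V) :=
    (measurable_massRecAC M₁ Rcol εL εS av k h).ennreal_ofReal
  have hle : (fieldMeasure P k G).withDensity (fun V => ENNReal.ofReal (massRecAC M₁ Rcol εL εS av k h V)) ≤
      (fieldMeasure P k G).withDensity ((fun _ => (1 : ℝ≥0∞)) + B k) := by
    calc (fieldMeasure P k G).withDensity (fun V => ENNReal.ofReal (massRecAC M₁ Rcol εL εS av k h V))
        ≤ fieldMeasure P k G + ν k := withDensity_massRecAC_le_of_weakClosed M₁ Rcol εL εS av hav Kt ν hstep k hk h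
      _ ≤ (fieldMeasure P k G).withDensity (fun _ => (1 : ℝ≥0∞)) + (fieldMeasure P k G).withDensity (B k) := by
          rw [withDensity_const, one_smul]; exact add_le_add le_rfl (hνB k hk)
      _ = (fieldMeasure P k G).withDensity ((fun _ => (1 : ℝ≥0∞)) + B k) := (withDensity_add_left measurable_const _).symm
  have h1 := rnDeriv_le_of_le_withDensity hle
  have h2 := Measure.rnDeriv_withDensity (fieldMeasure P k G) hmeas
  filter_upwards [h1, h2] with V hV1 hV2
  rw [← hV2]
  exact hV1

/-- **… real form**: `b_k ≥ 0` with `ν_k ≤ dU_k.withDensity (ofReal ∘ b_k)` ⇒ `m_k(h,V) ≤ 1 + b_k V` for `dU_k`-a.e. `V`, `k ≤ K̄`. [folklore] -/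
theorem massRecAC_le_ae_of_weakClosed_real (Kt : ℕ) (ν : ∀ k, Measure (GaugeField P k G))
    (hstep : ∀ k, k < Kt → (fieldMeasure P k G + ν k).map (av k).avg ≤ fieldMeasure P (k + 1) G + ν (k + 1))
    (b : ∀ k, GaugeField P k G → ℝ) (hb0 : ∀ k V, 0 ≤ b k V)
    (hνb : ∀ k, k ≤ Kt → ν k ≤ (fieldMeasure P k G).withDensity (fun V => ENNReal.ofReal (b k V))) (k : ℕ) (hk : k ≤ Kt) (h : Hist P k) :
    ∀ᵐ V ∂(fieldMeasure P k G), massRecAC M₁ Rcol εL εS av k h V ≤ 1 + b k V := by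
  filter_upwards [massRecAC_le_ae_of_weakClosed M₁ Rcol εL εS av hav Kt ν hstep (fun k V => ENNReal.ofReal (b k V)) hνb k hk h] with V hV
  rw [← ENNReal.ofReal_one, ← ENNReal.ofReal_add zero_le_one (hb0 k V)] at hV
  exact (ENNReal.ofReal_le_ofReal_iff (by linarith [hb0 k V])).1 hV

/-- ★ **THE EXTENSIVE COROLLARY under weak closure — the a.e. form of file 15's `hmass`**: `ν_k ≤ (e^{c_k} − 1)·dU_k` (`c_k ≥ 0`; at the [B10] slot
`c_k = c_m·|T₁^{(k)}|`) for `k ≤ K̄` ⇒ `m_k(h,V) ≤ e^{c_k}` for `dU_k`-a.e. `V`. [cite: Balaban1985UV3, (41) p.266 + (5) p.256 (the extensive shape)] -/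
theorem massRecAC_le_exp_ae_of_weakClosed (Kt : ℕ) (ν : ∀ k, Measure (GaugeField P k G))
    (hstep : ∀ k, k < Kt → (fieldMeasure P k G + ν k).map (av k).avg ≤ fieldMeasure P (k + 1) G + ν (k + 1))
    (c : ℕ → ℝ) (hc : ∀ k, 0 ≤ c k) (hνc : ∀ k, k ≤ Kt → ν k ≤ ENNReal.ofReal (Real.exp (c k) - 1) • fieldMeasure P k G)
    (k : ℕ) (hk : k ≤ Kt) (h : Hist P k) :
    ∀ᵐ V ∂(fieldMeasure P k G), massRecAC M₁ Rcol εL εS av k h V ≤ Real.exp (c k) := by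
  have hb0 : ∀ k, 0 ≤ Real.exp (c k) - 1 := fun k => by linarith [Real.add_one_le_exp (c k), hc k]
  have hνb : ∀ k, k ≤ Kt → ν k ≤ (fieldMeasure P k G).withDensity (fun _ => ENNReal.ofReal (Real.exp (c k) - 1)) := fun k hk => by
    rw [withDensity_const]; exact hνc k hk
  filter_upwards [massRecAC_le_ae_of_weakClosed_real M₁ Rcol εL εS av hav Kt ν hstep (fun k _ => Real.exp (c k) - 1)
    (fun k _ => hb0 k) hνb k hk h] with V hV
  linarith

end WeakClosure

/-! ## §4 The least weakly-closed family: the iterated one-step excess over Haar -/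
section Least

variable {P : Params} {G : Type} [GaugeGroup G] [MeasurableSpace G] [HaarData G] (av : ∀ j, Averaging P j G)

/-- **THE EXCESS RECURSION IS INHABITED**: there is a family with `ν♯_0 = 0` and `ν♯_{k+1} = (dU_k + ν♯_k)∘Ū_k⁻¹ − dU_{k+1}` (Mathlib's truncated subtraction of
measures: `μ − λ` is the least `τ` with `μ ≤ τ + λ`), by recursion on the level. [folklore] -/
theorem exists_excessRec :
    ∃ νs : ∀ k, Measure (GaugeField P k G), νs 0 = 0 ∧
      ∀ k, νs (k + 1) = (fieldMeasure P k G + νs k).map (av k).avg - fieldMeasure P (k + 1) G :=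
  ⟨fun k => Nat.rec (motive := fun k => Measure (GaugeField P k G)) 0
      (fun k νk => (fieldMeasure P k G + νk).map (av k).avg - fieldMeasure P (k + 1) G) k, rfl, fun _ => rfl⟩

variable {av} (νs : ∀ k, Measure (GaugeField P k G)) (h0 : νs 0 = 0)
  (hsucc : ∀ k, νs (k + 1) = (fieldMeasure P k G + νs k).map (av k).avg - fieldMeasure P (k + 1) G)
include h0 hsucc

/-- Every member of an excess-recursive family is a FINITE measure (`ν♯_{k+1} ≤ (dU_k + ν♯_k)∘Ū_k⁻¹`, `Measure.sub_le`). [folklore] -/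
theorem isFiniteMeasure_of_excessRec : ∀ k, IsFiniteMeasure (νs k)
  | 0 => by rw [h0]; infer_instance
  | k + 1 => by
    haveI := isFiniteMeasure_of_excessRec k
    rw [hsucc k]
    exact isFiniteMeasure_of_le _ Measure.sub_le

/-- ★ **AN EXCESS-RECURSIVE FAMILY IS WEAKLY CLOSED: `(dU_k + ν♯_k)∘Ū_k⁻¹ ≤ dU_{k+1} + ν♯_{k+1}`** (finite measures: `μ ≤ (μ − λ) + λ`, Mathlib
`Measure.sub_le_iff_le_add`). [folklore] -/
theorem weakClosed_of_excessRec (k : ℕ) :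
    (fieldMeasure P k G + νs k).map (av k).avg ≤ fieldMeasure P (k + 1) G + νs (k + 1) := by
  haveI := isFiniteMeasure_of_excessRec νs h0 hsucc k
  rw [hsucc k]
  calc (fieldMeasure P k G + νs k).map (av k).avg
      ≤ ((fieldMeasure P k G + νs k).map (av k).avg - fieldMeasure P (k + 1) G) + fieldMeasure P (k + 1) G :=
        Measure.sub_le_iff_le_add.mp le_rfl
    _ = fieldMeasure P (k + 1) G + ((fieldMeasure P k G + νs k).map (av k).avg - fieldMeasure P (k + 1) G) := add_comm _ _

/-- ★★★ **MINIMALITY: an excess-recursive family with `ν♯_0 = 0` lies BELOW EVERY weakly-closed family, levelwise** — if `(dU_k + ν_k)∘Ū_k⁻¹ ≤ dU_{k+1} + ν_{k+1}`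
for `k < K̄` then `ν♯_k ≤ ν_k` for `k ≤ K̄` (`Measure.sub_le_of_le_add`, `Measure.map_mono`).  Hence the hypotheses of §2∕§3 are WEAKEST at `ν♯`. [folklore] -/
theorem excessRec_le_of_weakClosed (hmeas : ∀ j, Measurable (av j).avg) (Kt : ℕ) (ν : ∀ k, Measure (GaugeField P k G))
    (hstep : ∀ k, k < Kt → (fieldMeasure P k G + ν k).map (av k).avg ≤ fieldMeasure P (k + 1) G + ν (k + 1)) :
    ∀ k, k ≤ Kt → νs k ≤ ν k := by
  intro k
  induction k with
  | zero => intro _; rw [h0]; exact Measure.zero_le _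
  | succ k ih =>
    intro hk
    rw [hsucc k]
    refine Measure.sub_le_of_le_add ?_
    calc (fieldMeasure P k G + νs k).map (av k).avg ≤ (fieldMeasure P k G + ν k).map (av k).avg :=
          Measure.map_mono (add_le_add le_rfl (ih (by omega))) (hmeas k)
      _ ≤ fieldMeasure P (k + 1) G + ν (k + 1) := hstep k (by omega)
      _ = ν (k + 1) + fieldMeasure P (k + 1) G := add_comm _ _

omit h0 in
/-- ★ **ONE-STEP BOUND: `ν♯_{k+1} ≤ (dU_k∘Ū_k⁻¹ − dU_{k+1}) + ν♯_k∘Ū_k⁻¹`** — the new excess is at most the ONE-STEP EXCESS OF THE AVERAGING OVER HAAR (the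
measure by which `Ū_k` fails Haar compatibility from above; `0` under E6′) plus the transport of the old excess (`Measure.map_add`; finiteness of `dU_k∘Ū_k⁻¹`).
[cite: Balaban1985Averaging, (15) p.19 + (13) p.19 (Haar invariance; bookkeeping)] -/
theorem excessRec_succ_le (hmeas : ∀ j, Measurable (av j).avg) (k : ℕ) :
    νs (k + 1) ≤ ((fieldMeasure P k G).map (av k).avg - fieldMeasure P (k + 1) G) + (νs k).map (av k).avg := by
  rw [hsucc k, Measure.map_add _ _ (hmeas k)]
  refine Measure.sub_le_of_le_add ?_
  have h1 : (fieldMeasure P k G).map (av k).avg ≤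
      ((fieldMeasure P k G).map (av k).avg - fieldMeasure P (k + 1) G) + fieldMeasure P (k + 1) G :=
    Measure.sub_le_iff_le_add.mp le_rfl
  calc (fieldMeasure P k G).map (av k).avg + (νs k).map (av k).avg
      ≤ ((fieldMeasure P k G).map (av k).avg - fieldMeasure P (k + 1) G) + fieldMeasure P (k + 1) G + (νs k).map (av k).avg :=
        add_le_add h1 le_rfl
    _ = ((fieldMeasure P k G).map (av k).avg - fieldMeasure P (k + 1) G) + (νs k).map (av k).avg + fieldMeasure P (k + 1) G :=
        add_right_comm _ _ _

/-- **MASS BOOKKEEPING: `ν♯_k(univ) ≤ Σ_{j<k} (dU_j∘Ū_j⁻¹ − dU_{j+1})(univ)`** — the total excess is at most the sum of the one-step excess masses (transport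
preserves total mass). [folklore] -/
theorem excessRec_univ_le (hmeas : ∀ j, Measurable (av j).avg) :
    ∀ k, νs k Set.univ ≤ ∑ j ∈ Finset.range k, ((fieldMeasure P j G).map (av j).avg - fieldMeasure P (j + 1) G) Set.univ
  | 0 => by rw [h0]; simp
  | k + 1 => by
    have h1 := excessRec_succ_le νs hsucc hmeas k
    have hmap : (νs k).map (av k).avg Set.univ = νs k Set.univ := by
      rw [Measure.map_apply (hmeas k) MeasurableSet.univ, Set.preimage_univ]
    calc νs (k + 1) Set.univ
        ≤ (((fieldMeasure P k G).map (av k).avg - fieldMeasure P (k + 1) G) + (νs k).map (av k).avg) Set.univ := h1 Set.univ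
      _ = ((fieldMeasure P k G).map (av k).avg - fieldMeasure P (k + 1) G) Set.univ + νs k Set.univ := by
          rw [Measure.add_apply, hmap]
      _ ≤ ((fieldMeasure P k G).map (av k).avg - fieldMeasure P (k + 1) G) Set.univ +
            ∑ j ∈ Finset.range k, ((fieldMeasure P j G).map (av j).avg - fieldMeasure P (j + 1) G) Set.univ :=
          add_le_add le_rfl (excessRec_univ_le hmeas k)
      _ = ∑ j ∈ Finset.range (k + 1), ((fieldMeasure P j G).map (av j).avg - fieldMeasure P (j + 1) G) Set.univ := by
          rw [Finset.sum_range_succ, add_comm]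

omit h0 hsucc in
/-- ★ **THE TRANSPORTED ONE-STEP EXCESSES FORM A WEAKLY-CLOSED FAMILY**: any family with `μ_{k+1} ≥ (dU_k∘Ū_k⁻¹ − dU_{k+1}) + μ_k∘Ū_k⁻¹` (`k < K̄`) — e.g. WITH
equality: `μ_k = Σ_{j<k} (Ū_{k−1}∘⋯∘Ū_{j+1})_*[(dU_j∘Ū_j⁻¹ − dU_{j+1})⁺]`, the one-step excesses of the averagings over Haar, transported — is weakly closed
(`dU_k∘Ū_k⁻¹ ≤ (dU_k∘Ū_k⁻¹ − dU_{k+1}) + dU_{k+1}`, finiteness); by minimality `ν♯ ≤ μ`.  This is the EXPLICIT intermediate target between `ν♯` and n08-w3's guard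
family: bound the densities of transported ONE-STEP EXCESS measures (small-mass measures), not of transported Haar copies. [cite: Balaban1985Averaging, (13)+(15) p.19 (bookkeeping)] -/
theorem weakClosed_of_oneStepExcessRec (hmeas : ∀ j, Measurable (av j).avg) (Kt : ℕ) (μ : ∀ k, Measure (GaugeField P k G))
    (hrec : ∀ k, k < Kt → ((fieldMeasure P k G).map (av k).avg - fieldMeasure P (k + 1) G) + (μ k).map (av k).avg ≤ μ (k + 1)) :
    ∀ k, k < Kt → (fieldMeasure P k G + μ k).map (av k).avg ≤ fieldMeasure P (k + 1) G + μ (k + 1) := by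
  intro k hk
  rw [Measure.map_add _ _ (hmeas k)]
  have h1 : (fieldMeasure P k G).map (av k).avg ≤
      ((fieldMeasure P k G).map (av k).avg - fieldMeasure P (k + 1) G) + fieldMeasure P (k + 1) G :=
    Measure.sub_le_iff_le_add.mp le_rfl
  have h1' : (fieldMeasure P k G).map (av k).avg ≤
      fieldMeasure P (k + 1) G + ((fieldMeasure P k G).map (av k).avg - fieldMeasure P (k + 1) G) :=
    h1.trans (le_of_eq (add_comm ((fieldMeasure P k G).map (av k).avg - fieldMeasure P (k + 1) G) (fieldMeasure P (k + 1) G)))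
  calc (fieldMeasure P k G).map (av k).avg + (μ k).map (av k).avg
      ≤ fieldMeasure P (k + 1) G + ((fieldMeasure P k G).map (av k).avg - fieldMeasure P (k + 1) G) + (μ k).map (av k).avg :=
        add_le_add h1' le_rfl
    _ = fieldMeasure P (k + 1) G + (((fieldMeasure P k G).map (av k).avg - fieldMeasure P (k + 1) G) + (μ k).map (av k).avg) :=
        add_assoc _ _ _
    _ ≤ fieldMeasure P (k + 1) G + μ (k + 1) := add_le_add le_rfl (hrec k hk)

/-- … hence `ν♯_k ≤ μ_k` (`k ≤ K̄`) for every such family `μ` (§4 minimality). [folklore] -/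
theorem excessRec_le_of_oneStepExcessRec (hmeas : ∀ j, Measurable (av j).avg) (Kt : ℕ) (μ : ∀ k, Measure (GaugeField P k G))
    (hrec : ∀ k, k < Kt → ((fieldMeasure P k G).map (av k).avg - fieldMeasure P (k + 1) G) + (μ k).map (av k).avg ≤ μ (k + 1)) :
    ∀ k, k ≤ Kt → νs k ≤ μ k :=
  excessRec_le_of_weakClosed νs h0 hsucc hmeas Kt μ (weakClosed_of_oneStepExcessRec hmeas Kt μ hrec)

omit h0 hsucc in
/-- **Under (sub-)Haar compatibility the one-step excess VANISHES**: `(dU_k)∘Ū_k⁻¹ ≤ dU_{k+1} ⇒ dU_k∘Ū_k⁻¹ − dU_{k+1} = 0` (`Measure.sub_eq_zero_of_le`); hence an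
excess-recursive family is identically `0` up to any level below which the averaging is Haar compatible (`excessRec_eq_zero_of_map_le`). [folklore] -/
theorem oneStepExcess_eq_zero_of_map_le (k : ℕ) (hH : (fieldMeasure P k G).map (av k).avg ≤ fieldMeasure P (k + 1) G) :
    (fieldMeasure P k G).map (av k).avg - fieldMeasure P (k + 1) G = 0 :=
  Measure.sub_eq_zero_of_le hH

/-- `ν♯_k = 0` for `k ≤ K̄` if `(dU_j)∘Ū_j⁻¹ ≤ dU_{j+1}` for `j < K̄`. [folklore] -/
theorem excessRec_eq_zero_of_map_le (Kt : ℕ) (hH : ∀ j, j < Kt → (fieldMeasure P j G).map (av j).avg ≤ fieldMeasure P (j + 1) G) :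
    ∀ k, k ≤ Kt → νs k = 0 := by
  intro k
  induction k with
  | zero => intro _; exact h0
  | succ k ih =>
    intro hk
    rw [hsucc k, ih (by omega), add_zero]
    exact Measure.sub_eq_zero_of_le (hH k (by omega))

end Least

/-! ## §5 Haar compatibility ⇒ the std lane's cap `m_k ≤ 1`, almost everywhere, for the AC masses -/
section HaarCap

variable {P : Params} {G : Type} [GaugeGroup G] [MeasurableSpace G] [HaarData G]
  (M₁ : ℕ) (Rcol : ℕ → ℕ) (εL εS : ℕ → ℝ) (av : ∀ j, Averaging P j G) (hav : ∀ j, AvgAC (av j).avg)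
include hav

/-- ★★ **SUB-HAAR COMPATIBILITY UP TO LEVEL `k` ⇒ `m_k(h,·)·dU_k ≤ dU_k`** (the family `ν := 0` is weakly closed). [cite: Balaban1985UV3, (41) p.266; Balaban1985Averaging, (13)+(15) p.19] -/
theorem withDensity_massRecAC_le_of_map_le (k : ℕ) (hH : ∀ j, j < k → (fieldMeasure P j G).map (av j).avg ≤ fieldMeasure P (j + 1) G) (h : Hist P k) :
    (fieldMeasure P k G).withDensity (fun V => ENNReal.ofReal (massRecAC M₁ Rcol εL εS av k h V)) ≤ fieldMeasure P k G := by
  have h1 := withDensity_massRecAC_le_of_weakClosed M₁ Rcol εL εS av hav k (fun _ => 0)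
    (fun j hj => by rw [add_zero, add_zero]; exact hH j hj) k le_rfl h
  rwa [add_zero] at h1

/-- ★★ **SUB-HAAR (⇔ EXACT HAAR) COMPATIBILITY `(dU_j)∘Ū_j⁻¹ ≤ dU_{j+1}` FOR `j < k` ⇒ `m_k(h,V) ≤ 1` FOR `dU_k`-a.e. `V`**, every history: E6′ — as an (in)equality of
measures — makes the uncapped Radon–Nikodym masses of the AC lane obey the cap the std lane BUILDS IN (`Carriers.Masses.massRec := min 1 …`); the least
closed family is `0`.  (For probability measures `≤` here is `=`.) [cite: Balaban1985UV3, (41) p.266; Balaban1985Averaging, (13)+(15) p.19] -/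
theorem massRecAC_le_one_ae_of_map_le (k : ℕ) (hH : ∀ j, j < k → (fieldMeasure P j G).map (av j).avg ≤ fieldMeasure P (j + 1) G) (h : Hist P k) :
    ∀ᵐ V ∂(fieldMeasure P k G), massRecAC M₁ Rcol εL εS av k h V ≤ 1 := by
  have h1 := massRecAC_le_ae_of_weakClosed_real M₁ Rcol εL εS av hav k (fun _ => 0)
    (fun j hj => by rw [add_zero, add_zero]; exact hH j hj) (fun _ _ => 0) (fun _ _ => le_rfl)
    (fun j _ => by exact Measure.zero_le _) k le_rfl h
  filter_upwards [h1] with V hV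
  linarith

end HaarCap

end Summit.QuantumFields.YangMills.BalabanUVNodes.N08MassesACLeastClosedFamily

end
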